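import Summits.Ventures.CertifiedManyBodySolver.Observables.StiffnessTLOddMomentLocalObs
import Literature.MathematicalPhysics.QuantumLattice.HubbardNNNHoppingLocalHamiltonian
import Literature.MathematicalPhysics.QuantumLattice.HubbardNNNHoppingWindowCertificate
import HarnessLib

/-!
# Ventures/CertifiedManyBodySolver — Observables: the local observables of the odd-moment (Krylov-3)
# stiffness row for the `t–t'` square torus (`t = 1`, any real `t'`, e.g. the A0 anchor `t' = −1/4`)

HONEST FRAMING: one-sided CEILINGS on the flux stiffness (helicity modulus / superfluid weight); not
a superconductivity verdict; no stiffness floor follows from equal-time data and an energy window.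

Cell `hubbard-obs` (D-0042), seat p2 (stiffness). `t'`-general twin of `StiffnessTLOddMomentLocalObs.lean`
(which is the `t' = 0` case): the `e₁`-kinetic and `e₁`-current operators of the `t–t'` torus
(`kinOpTT' L t'`, `curOpTT' L t'`: nearest-neighbour `e₁`-bonds plus both diagonal families `x → x + j_s`,
`j₀ = (1,1)`, `j₁ = (1,−1)`, weighted `t'`) as translation sums of bond observables in `𝔄_{[-1,1]²}`, and the
LOCAL COMMUTATORS `b₀ = [H^{tt'}_{[-2,2]²}, j₀]`, `c₀ = [H^{tt'}_{[-3,3]²}, b₀]` with the free-boundary `t–t'–U`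
Hamiltonians (`hubbardTTPrimeFermionInteraction 1 t' U`), the local densities `d₁`, `m₃'` (`commDensity`) and
the per-side / limit functionals of the fixed-`λ` row. Everything is a definition or PROVED (graded locality
`hubbardTorusTT'_commutator_fermionEmbed`, translation invariance `relabel_translate_hubbardTorusTT'`).

* `kinOpTT' L t' = Σ_v T_v Γ(kinBondObsTT t')`, `curOpTT' L t' = Σ_v T_v Γ(curBondObsTT t')`;
* `H𝒥 − 𝒥H = Σ_v T_v Γ(curDerivObsTT t' U)` (`L ≥ 7`), `HB − BH = Σ_v T_v Γ(curDeriv2ObsTT t' U)` (`L ≥ 9`),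
  `H = hubbardTorusTT' L 1 t' U`, `𝒥 = curOpTT' L t'`, `B = H𝒥 − 𝒥H`;
* evenness of the observables; `Bᴴ = −B`;
* `oddMomentFunctionalTT' t' U δ λ L ψ = (½Re⟨ψ,𝒦ψ⟩ + 2λ m₁(ψ) + λ² m₃(ψ))/L²` (sector energy `fluxEnergyTT' L t' U δ 0`)
  and `oddMomentLimitFunctionalTT t' U λ ω = ½Re ω(k₀) + λ Re ω(d₁) − (λ²/2) Re ω(m₃')`.

References: [ScalapinoWhiteZhang1993] §II; [HazraVermaRanderia2019] eq. (4); [Lipparini2008] eq. (8.30);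
[XuEtAl2024] eq. (1); [BratteliRobinsonII1997] §5.2.2, §6.2.1, Thm. 6.2.4.
-/

noncomputable section

namespace Summit.Ventures.CertifiedManyBodySolver.Observables

open Matrix Finset Filter Topology
open Literature.MathematicalPhysics.QuantumLattice
open Literature.MathematicalPhysics.QuantumLattice.ThermodynamicLimit
open Literature.MathematicalPhysics.QuantumFieldTheory
open Literature.Probability.LatticeModels
open scoped ComplexOrder ComplexConjugate Topology

/-! ### The diagonal vectors -/

/-- `j_s ∈ [-1,1]²` (`j₀ = (1,1)`, `j₁ = (1,−1)`). [folklore] -/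
theorem diagVec_mem_box_one (s : Fin 2) : diagVec s ∈ box 2 1 := by
  rw [mem_box]
  intro i
  fin_cases i <;> fin_cases s <;> simp [diagVec]

/-! ### The local observables -/

/-- The **`x₁`-advancing kinetic bond observable of the `t–t'` model**:
`k₀ + t' Σ_s Σ_σ (c†_{j_sσ} c_{0σ} + c†_{0σ} c_{j_sσ}) ∈ 𝔄_{[-1,1]²}` (translation sum `= kinOpTT' L t'`).
[cite: HazraVermaRanderia2019, eq. (4)] -/
def kinBondObsTT (tp : ℝ) : FermionOp (box 2 1) :=
  kinBondObs + ((tp : ℝ) : ℂ) • ∑ s : Fin 2, ∑ σ : Fin 2,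
    ((cAt (diagVec s) (diagVec_mem_box_one s) σ)ᴴ * cAt 0 zero_mem_box_one σ +
      (cAt 0 zero_mem_box_one σ)ᴴ * cAt (diagVec s) (diagVec_mem_box_one s) σ)

/-- The **`x₁`-advancing current bond observable of the `t–t'` model**:
`j₀ + t' Σ_s Σ_σ (−i c†_{j_sσ} c_{0σ} + i c†_{0σ} c_{j_sσ}) ∈ 𝔄_{[-1,1]²}` (translation sum `= curOpTT' L t'`).
[cite: ScalapinoWhiteZhang1993, §II] -/
def curBondObsTT (tp : ℝ) : FermionOp (box 2 1) :=
  curBondObs + ((tp : ℝ) : ℂ) • ∑ s : Fin 2, ∑ σ : Fin 2,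
    ((-Complex.I) • ((cAt (diagVec s) (diagVec_mem_box_one s) σ)ᴴ * cAt 0 zero_mem_box_one σ) +
      Complex.I • ((cAt 0 zero_mem_box_one σ)ᴴ * cAt (diagVec s) (diagVec_mem_box_one s) σ))

/-- `b₀ = [H^{tt'}_{[-2,2]²}, j₀] ∈ 𝔄_{[-2,2]²}` (free-boundary `t–t'–U` Hamiltonian, `t = 1`).
[cite: BratteliRobinsonII1997, Thm. 6.2.4] -/
def curDerivObsTT (tp U : ℝ) : FermionOp (box 2 2) :=
  (hubbardTTPrimeFermionInteraction 1 tp U).localHamiltonian (box 2 2) *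
      fermionEmbed (PolySite.incl (box_subset_box (by norm_num))) (curBondObsTT tp) -
    fermionEmbed (PolySite.incl (box_subset_box (by norm_num))) (curBondObsTT tp) *
      (hubbardTTPrimeFermionInteraction 1 tp U).localHamiltonian (box 2 2)

/-- `c₀ = [H^{tt'}_{[-3,3]²}, b₀] ∈ 𝔄_{[-3,3]²}`. [cite: BratteliRobinsonII1997, Thm. 6.2.4] -/
def curDeriv2ObsTT (tp U : ℝ) : FermionOp (box 2 3) :=
  (hubbardTTPrimeFermionInteraction 1 tp U).localHamiltonian (box 2 3) *
      fermionEmbed (PolySite.incl (box_subset_box (by norm_num))) (curDerivObsTT tp U) -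
    fermionEmbed (PolySite.incl (box_subset_box (by norm_num))) (curDerivObsTT tp U) *
      (hubbardTTPrimeFermionInteraction 1 tp U).localHamiltonian (box 2 3)

/-- `d₁ = Σ_{z∈[-3,3]²} [τ_z j₀, b₀] ∈ 𝔄_{[-4,4]²}`, the local density of `[𝒥,[H,𝒥]]`. [cite: Lipparini2008, eq. (8.30)] -/
def firstMomentObsTT (tp U : ℝ) : FermionOp (box 2 4) :=
  commDensity (box 2 4) (box 2 3) (box_subset_box (by norm_num)) (curBondObsTT tp) (curDerivObsTT tp U)

/-- `m₃' = Σ_{z∈[-5,5]²} [τ_z b₀, c₀] ∈ 𝔄_{[-7,7]²}`, the local density of `[B,[H,B]]`. [cite: Lipparini2008, eq. (8.30)] -/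
def thirdMomentObsTT (tp U : ℝ) : FermionOp (box 2 7) :=
  commDensity (box 2 7) (box 2 5) (box_subset_box (by norm_num)) (curDerivObsTT tp U) (curDeriv2ObsTT tp U)

/-- The limit functional of the row at fixed `λ`: `½Re ω(k₀) + λ Re ω(d₁) − (λ²/2) Re ω(m₃')`.
[cite: Lipparini2008, eq. (8.30)] -/
def oddMomentLimitFunctionalTT (tp U lam : ℝ) (ω : InfVolFermionState 2) : ℝ :=
  (ω.expect (box 2 1) (kinBondObsTT tp)).re / 2 + lam * (ω.expect (box 2 4) (firstMomentObsTT tp U)).re -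
    lam ^ 2 / 2 * (ω.expect (box 2 7) (thirdMomentObsTT tp U)).re

/-- The per-side odd-moment functional of the `t–t'` torus at fixed `λ`:
`(½Re⟨ψ,𝒦ψ⟩ + 2λ m₁(ψ) + λ² m₃(ψ))/L²`, `𝒦 = kinOpTT' L t'`, `𝒥 = curOpTT' L t'`, `H = hubbardTorusTT' L 1 t' U`,
`m₁ = Re⟨𝒥ψ,H𝒥ψ⟩ − E₀‖𝒥ψ‖²`, `B = H𝒥 − 𝒥H`, `m₃ = Re⟨Bψ,HBψ⟩ − E₀‖Bψ‖²`, `E₀ = fluxEnergyTT' L t' U δ 0`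
(junk value `0` at `L = 0`). [cite: Lipparini2008, eq. (8.30)] -/
def oddMomentFunctionalTT' (tp U δ lam : ℝ) (L : ℕ) (ψ : Fock (Orb (FermionTorus 2 L))) : ℝ :=
  if hL : L = 0 then 0 else
    haveI : NeZero L := ⟨hL⟩
    ((star ψ ⬝ᵥ (kinOpTT' L tp *ᵥ ψ)).re / 2 +
        2 * lam * ((star (curOpTT' L tp *ᵥ ψ) ⬝ᵥ (hubbardTorusTT' L 1 tp U *ᵥ (curOpTT' L tp *ᵥ ψ))).re -
          fluxEnergyTT' L tp U δ 0 * (star (curOpTT' L tp *ᵥ ψ) ⬝ᵥ (curOpTT' L tp *ᵥ ψ)).re) +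
        lam ^ 2 * ((star ((hubbardTorusTT' L 1 tp U * curOpTT' L tp - curOpTT' L tp * hubbardTorusTT' L 1 tp U) *ᵥ ψ) ⬝ᵥ
            (hubbardTorusTT' L 1 tp U *ᵥ
              ((hubbardTorusTT' L 1 tp U * curOpTT' L tp - curOpTT' L tp * hubbardTorusTT' L 1 tp U) *ᵥ ψ))).re -
          fluxEnergyTT' L tp U δ 0 *
            (star ((hubbardTorusTT' L 1 tp U * curOpTT' L tp - curOpTT' L tp * hubbardTorusTT' L 1 tp U) *ᵥ ψ) ⬝ᵥ
              ((hubbardTorusTT' L 1 tp U * curOpTT' L tp - curOpTT' L tp * hubbardTorusTT' L 1 tp U) *ᵥ ψ)).re)) /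
      (L : ℝ) ^ 2

/-- `oddMomentFunctionalTT'` at a side `L ≠ 0`. [cite: Lipparini2008, eq. (8.30)] -/
theorem oddMomentFunctionalTT'_eq (tp U δ lam : ℝ) (L : ℕ) [NeZero L] (ψ : Fock (Orb (FermionTorus 2 L))) :
    oddMomentFunctionalTT' tp U δ lam L ψ =
      ((star ψ ⬝ᵥ (kinOpTT' L tp *ᵥ ψ)).re / 2 +
        2 * lam * ((star (curOpTT' L tp *ᵥ ψ) ⬝ᵥ (hubbardTorusTT' L 1 tp U *ᵥ (curOpTT' L tp *ᵥ ψ))).re -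
          fluxEnergyTT' L tp U δ 0 * (star (curOpTT' L tp *ᵥ ψ) ⬝ᵥ (curOpTT' L tp *ᵥ ψ)).re) +
        lam ^ 2 * ((star ((hubbardTorusTT' L 1 tp U * curOpTT' L tp - curOpTT' L tp * hubbardTorusTT' L 1 tp U) *ᵥ ψ) ⬝ᵥ
            (hubbardTorusTT' L 1 tp U *ᵥ
              ((hubbardTorusTT' L 1 tp U * curOpTT' L tp - curOpTT' L tp * hubbardTorusTT' L 1 tp U) *ᵥ ψ))).re -
          fluxEnergyTT' L tp U δ 0 *
            (star ((hubbardTorusTT' L 1 tp U * curOpTT' L tp - curOpTT' L tp * hubbardTorusTT' L 1 tp U) *ᵥ ψ) ⬝ᵥ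
              ((hubbardTorusTT' L 1 tp U * curOpTT' L tp - curOpTT' L tp * hubbardTorusTT' L 1 tp U) *ᵥ ψ)).re)) /
      (L : ℝ) ^ 2 := by
  rw [oddMomentFunctionalTT', dif_neg (NeZero.ne L)]

/-! ### Evenness -/

/-- The `t–t'` bond current is even. [cite: BratteliRobinsonII1997, §5.2.2] -/
theorem curBondObsTT_mem_carEvenSubalgebra (tp : ℝ) :
    curBondObsTT tp ∈ carEvenSubalgebra (Finset.univ : Finset (Orb (PolySite (box 2 1)))) := by
  unfold curBondObsTT
  refine Subalgebra.add_mem _ curBondObs_mem_carEvenSubalgebra (Subalgebra.smul_mem _ ?_ _)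
  refine Subalgebra.sum_mem _ fun s _ => Subalgebra.sum_mem _ fun σ _ =>
    Subalgebra.add_mem _ (Subalgebra.smul_mem _ ?_ _) (Subalgebra.smul_mem _ ?_ _) <;>
  · rw [cAt, cAt, annihilation_conjTranspose]
    exact creation_mul_annihilation_mem_carEvenSubalgebra (Finset.mem_univ _) (Finset.mem_univ _)

/-- A local Hamiltonian all of whose potentials are even is even. [cite: BratteliRobinsonII1997, §5.2.2] -/
theorem localHamiltonian_mem_carEvenSubalgebra_of_forall {d : ℕ} (Ψ : FermionInteraction d)
    (hΨ : ∀ X : Finset (Site d), Ψ.Φ X ∈ carEvenSubalgebra (Finset.univ : Finset (Orb (PolySite X))))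
    (Λ : Finset (Site d)) :
    Ψ.localHamiltonian Λ ∈ carEvenSubalgebra (Finset.univ : Finset (Orb (PolySite Λ))) := by
  unfold FermionInteraction.localHamiltonian
  exact Subalgebra.sum_mem _ fun X _ =>
    carEvenSubalgebra_mono (Finset.subset_univ _) (fermionEmbed_mem_carEvenSubalgebra _ (hΨ X.1))

/-- Every potential of the diagonal hopping interaction is even. [cite: BratteliRobinsonII1997, §5.2.2] -/
theorem diagHoppingFermionInteraction_apply_mem_carEvenSubalgebra (tp : ℝ) (X : Finset (Site 2)) :
    (diagHoppingFermionInteraction tp).Φ X ∈ carEvenSubalgebra (Finset.univ : Finset (Orb (PolySite X))) := by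
  unfold diagHoppingFermionInteraction
  refine Subalgebra.sum_mem _ fun x _ => Subalgebra.sum_mem _ fun y _ => ?_
  split_ifs
  · refine Subalgebra.smul_mem _ (Subalgebra.sum_mem _ fun σ _ => Subalgebra.add_mem _ ?_ ?_) _ <;>
    · rw [cAt, cAt, annihilation_conjTranspose]
      exact creation_mul_annihilation_mem_carEvenSubalgebra (Finset.mem_univ _) (Finset.mem_univ _)
  · exact Subalgebra.zero_mem _

/-- The free-boundary `t–t'–U` Hamiltonian of a region is even. [cite: BratteliRobinsonII1997, §5.2.2] -/
theorem localHamiltonianTT_mem_carEvenSubalgebra (tp U : ℝ) (Λ : Finset (Site 2)) :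
    (hubbardTTPrimeFermionInteraction 1 tp U).localHamiltonian Λ ∈
      carEvenSubalgebra (Finset.univ : Finset (Orb (PolySite Λ))) := by
  rw [hubbardTTPrimeFermionInteraction_localHamiltonian]
  exact Subalgebra.add_mem _ (localHamiltonian_mem_carEvenSubalgebra 1 U Λ)
    (localHamiltonian_mem_carEvenSubalgebra_of_forall _ (diagHoppingFermionInteraction_apply_mem_carEvenSubalgebra tp) Λ)

/-- `b₀` is even. [cite: BratteliRobinsonII1997, §5.2.2] -/
theorem curDerivObsTT_mem_carEvenSubalgebra (tp U : ℝ) :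
    curDerivObsTT tp U ∈ carEvenSubalgebra (Finset.univ : Finset (Orb (PolySite (box 2 2)))) := by
  have hH := localHamiltonianTT_mem_carEvenSubalgebra tp U (box 2 2)
  have hj : fermionEmbed (PolySite.incl (box_subset_box (by norm_num : 1 ≤ 2))) (curBondObsTT tp) ∈
      carEvenSubalgebra (Finset.univ : Finset (Orb (PolySite (box 2 2)))) :=
    carEvenSubalgebra_mono (Finset.subset_univ _)
      (fermionEmbed_mem_carEvenSubalgebra _ (curBondObsTT_mem_carEvenSubalgebra tp))
  unfold curDerivObsTT
  exact Subalgebra.sub_mem _ (Subalgebra.mul_mem _ hH hj) (Subalgebra.mul_mem _ hj hH)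

/-! ### The `t–t'` kinetic and current operators as translation sums -/

section Finite

variable (L : ℕ) [NeZero L]

omit [NeZero L] in
/-- `0 mod L = 0`. [folklore] -/
private theorem proj_zero'' : Torus.proj L (0 : Site 2) = 0 := by
  funext j; simp [Torus.proj]

/-- The translate by `v` of the embedded diagonal hopping bond `c†_{j_s} c_0` (resp. `c†_0 c_{j_s}`).
[folklore] -/
private theorem relabel_translate_fermionEmbed_diag (h : Set.InjOn (Torus.proj (d := 2) L) ↑(box 2 1))
    (v : TorusSite 2 L) (s σ : Fin 2) :
    relabel (Orb.translate v) (fermionEmbed (PolySite.toTorusEmb L h)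
        ((cAt (diagVec s) (diagVec_mem_box_one s) σ)ᴴ * cAt 0 zero_mem_box_one σ)) =
      creation (orb (FermionTorus.ofTorusSite (v + torusDiagJump L s)) σ) *
        annihilation (orb (FermionTorus.ofTorusSite v) σ) ∧
    relabel (Orb.translate v) (fermionEmbed (PolySite.toTorusEmb L h)
        ((cAt 0 zero_mem_box_one σ)ᴴ * cAt (diagVec s) (diagVec_mem_box_one s) σ)) =
      creation (orb (FermionTorus.ofTorusSite v) σ) *
        annihilation (orb (FermionTorus.ofTorusSite (v + torusDiagJump L s)) σ) := by
  constructor <;>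
  · rw [cAt, cAt, annihilation_conjTranspose, fermionEmbed_mul, fermionEmbed_creation, fermionEmbed_annihilation,
      PolySite.toTorusEmb_pt, PolySite.toTorusEmb_pt, proj_zero'', proj_diagVec, relabel_mul,
      relabel_translate_creation, relabel_translate_annihilation, zero_add, add_comm (torusDiagJump L s) v]

/-- The diagonal hopping with unit amplitudes, summed site-first. [cite: Lieb1994, eq. (1)] -/
private theorem diagPeierlsHopping_one_eq :
    diagPeierlsHopping L (fun _ _ => (1 : ℂ)) =
      ∑ v : TorusSite 2 L, ∑ s : Fin 2, ∑ σ : Fin 2,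
        (creation (orb (FermionTorus.ofTorusSite (v + torusDiagJump L s)) σ) *
            annihilation (orb (FermionTorus.ofTorusSite v) σ) +
          creation (orb (FermionTorus.ofTorusSite v) σ) *
            annihilation (orb (FermionTorus.ofTorusSite (v + torusDiagJump L s)) σ)) := by
  unfold diagPeierlsHopping
  rw [Finset.sum_comm]
  refine Finset.sum_congr rfl fun v _ => Finset.sum_congr rfl fun s _ => Finset.sum_congr rfl fun σ _ => ?_
  rw [one_smul, map_one, one_smul]

/-- The diagonal hopping with amplitudes `−i`, summed site-first. [cite: Lieb1994, eq. (1)] -/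
private theorem diagPeierlsHopping_negI_eq :
    diagPeierlsHopping L (fun _ _ => -Complex.I) =
      ∑ v : TorusSite 2 L, ∑ s : Fin 2, ∑ σ : Fin 2,
        ((-Complex.I) • (creation (orb (FermionTorus.ofTorusSite (v + torusDiagJump L s)) σ) *
            annihilation (orb (FermionTorus.ofTorusSite v) σ)) +
          Complex.I • (creation (orb (FermionTorus.ofTorusSite v) σ) *
            annihilation (orb (FermionTorus.ofTorusSite (v + torusDiagJump L s)) σ))) := by
  unfold diagPeierlsHopping
  rw [Finset.sum_comm]
  refine Finset.sum_congr rfl fun v _ => Finset.sum_congr rfl fun s _ => Finset.sum_congr rfl fun σ _ => ?_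
  rw [Complex.conj_neg_I]

/-- **`𝒦 = Σ_v T_v Γ(k₀)` for the `t–t'` torus.** [cite: HazraVermaRanderia2019, eq. (4)] -/
theorem kinOpTT'_eq_sum_translate (tp : ℝ) (h : Set.InjOn (Torus.proj (d := 2) L) ↑(box 2 1)) :
    kinOpTT' L tp =
      ∑ v : TorusSite 2 L, relabel (Orb.translate v) (fermionEmbed (PolySite.toTorusEmb L h) (kinBondObsTT tp)) := by
  have hnn := kinOpTT'_zero_eq_sum_translate L h
  unfold kinOpTT' at hnn ⊢
  rw [Complex.ofReal_zero, zero_smul, add_zero] at hnn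
  rw [hnn, diagPeierlsHopping_one_eq, Finset.smul_sum, ← Finset.sum_add_distrib]
  refine Finset.sum_congr rfl fun v _ => ?_
  unfold kinBondObsTT
  rw [fermionEmbed_add, relabel_add, fermionEmbed_smul, relabel_smul, fermionEmbed_sum, relabel_sum]
  congr 2
  refine Finset.sum_congr rfl fun s _ => ?_
  rw [fermionEmbed_sum, relabel_sum]
  refine Finset.sum_congr rfl fun σ _ => ?_
  rw [fermionEmbed_add, relabel_add, (relabel_translate_fermionEmbed_diag L h v s σ).1,
    (relabel_translate_fermionEmbed_diag L h v s σ).2]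

/-- **`𝒥 = Σ_v T_v Γ(j₀)` for the `t–t'` torus.** [cite: ScalapinoWhiteZhang1993, §II] -/
theorem curOpTT'_eq_sum_translate (tp : ℝ) (h : Set.InjOn (Torus.proj (d := 2) L) ↑(box 2 1)) :
    curOpTT' L tp =
      ∑ v : TorusSite 2 L, relabel (Orb.translate v) (fermionEmbed (PolySite.toTorusEmb L h) (curBondObsTT tp)) := by
  have hnn := curOpTT'_zero_eq_sum_translate L h
  unfold curOpTT' at hnn ⊢
  rw [Complex.ofReal_zero, zero_smul, add_zero] at hnn
  rw [hnn, diagPeierlsHopping_negI_eq, Finset.smul_sum, ← Finset.sum_add_distrib]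
  refine Finset.sum_congr rfl fun v _ => ?_
  unfold curBondObsTT
  rw [fermionEmbed_add, relabel_add, fermionEmbed_smul, relabel_smul, fermionEmbed_sum, relabel_sum]
  congr 2
  refine Finset.sum_congr rfl fun s _ => ?_
  rw [fermionEmbed_sum, relabel_sum]
  refine Finset.sum_congr rfl fun σ _ => ?_
  rw [fermionEmbed_add, relabel_add, fermionEmbed_smul, relabel_smul, fermionEmbed_smul, relabel_smul,
    (relabel_translate_fermionEmbed_diag L h v s σ).1, (relabel_translate_fermionEmbed_diag L h v s σ).2]

/-! ### `[H^{tt'}, ·]` of translation sums; `B` and `[H,B]` as translation sums of local commutators -/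

/-- **The commutator of the `t–t'` torus Hamiltonian with a translation sum** of an embedded local
observable is the translation sum of the embedded LOCAL commutator (`Λ' ⊇ thicken Λ 1`, `x ↦ x mod L`
injective on `thicken Λ' 1`). [cite: BratteliRobinsonII1997, Thm. 6.2.4] -/
theorem hubbardTorusTT'_commutator_sum_relabel_translate (t tp U : ℝ) {Λ Λ' : Finset (Site 2)}
    (hΛ : Λ ⊆ Λ') (h8 : thicken Λ 1 ⊆ Λ') (hInj : Set.InjOn (Torus.proj (d := 2) L) ↑(thicken Λ' 1))
    (A : FermionOp Λ) :
    hubbardTorusTT' L t tp U *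
          (∑ v : TorusSite 2 L, relabel (Orb.translate v)
            (fermionEmbed (PolySite.toTorusEmb L (hInj.mono (by exact_mod_cast subset_thicken Λ' 1)))
              (fermionEmbed (PolySite.incl hΛ) A))) -
        (∑ v : TorusSite 2 L, relabel (Orb.translate v)
            (fermionEmbed (PolySite.toTorusEmb L (hInj.mono (by exact_mod_cast subset_thicken Λ' 1)))
              (fermionEmbed (PolySite.incl hΛ) A))) * hubbardTorusTT' L t tp U =
      ∑ v : TorusSite 2 L, relabel (Orb.translate v)
        (fermionEmbed (PolySite.toTorusEmb L (hInj.mono (by exact_mod_cast subset_thicken Λ' 1)))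
          ((hubbardTTPrimeFermionInteraction t tp U).localHamiltonian Λ' * fermionEmbed (PolySite.incl hΛ) A -
            fermionEmbed (PolySite.incl hΛ) A * (hubbardTTPrimeFermionInteraction t tp U).localHamiltonian Λ')) := by
  rw [Finset.mul_sum, Finset.sum_mul, ← Finset.sum_sub_distrib]
  refine Finset.sum_congr rfl fun v _ => ?_
  rw [← hubbardTorusTT'_commutator_fermionEmbed L t tp U hΛ h8 hInj A, relabel_sub, relabel_mul, relabel_mul,
    relabel_translate_hubbardTorusTT']

/-- **`H𝒥 − 𝒥H = Σ_v T_v Γ(b₀)`** for the `t–t'` torus (`L ≥ 7`). [cite: BratteliRobinsonII1997, Thm. 6.2.4] -/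
theorem hubbardTorusTT'_commutator_curOpTT' (tp U : ℝ) (hL : 7 ≤ L)
    (h : Set.InjOn (Torus.proj (d := 2) L) ↑(box 2 2)) :
    hubbardTorusTT' L 1 tp U * curOpTT' L tp - curOpTT' L tp * hubbardTorusTT' L 1 tp U =
      ∑ v : TorusSite 2 L, relabel (Orb.translate v)
        (fermionEmbed (PolySite.toTorusEmb L h) (curDerivObsTT tp U)) := by
  have hInj : Set.InjOn (Torus.proj (d := 2) L) ↑(thicken (box 2 2) 1) :=
    injOn_proj_thicken_box_one (by omega)
  have h12 : box 2 1 ⊆ box 2 2 := box_subset_box (by norm_num)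
  have hJ : curOpTT' L tp = ∑ v : TorusSite 2 L, relabel (Orb.translate v)
      (fermionEmbed (PolySite.toTorusEmb L (hInj.mono (by exact_mod_cast subset_thicken (box 2 2) 1)))
        (fermionEmbed (PolySite.incl h12) (curBondObsTT tp))) := by
    rw [curOpTT'_eq_sum_translate L tp (h.mono (Finset.coe_subset.2 h12))]
    refine Finset.sum_congr rfl fun v _ => ?_
    rw [fermionEmbed_toTorusEmb_incl]
  rw [hJ, hubbardTorusTT'_commutator_sum_relabel_translate L 1 tp U h12 (thicken_box_one_subset 2 1) hInj
    (curBondObsTT tp)]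
  rfl

/-- **`HB − BH = Σ_v T_v Γ(c₀)`** with `B = H𝒥 − 𝒥H`, `t–t'` torus (`L ≥ 9`). [cite: BratteliRobinsonII1997, Thm. 6.2.4] -/
theorem hubbardTorusTT'_commutator_commutator_curOpTT' (tp U : ℝ) (hL : 9 ≤ L)
    (h : Set.InjOn (Torus.proj (d := 2) L) ↑(box 2 3)) :
    hubbardTorusTT' L 1 tp U * (hubbardTorusTT' L 1 tp U * curOpTT' L tp - curOpTT' L tp * hubbardTorusTT' L 1 tp U) -
        (hubbardTorusTT' L 1 tp U * curOpTT' L tp - curOpTT' L tp * hubbardTorusTT' L 1 tp U) *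
          hubbardTorusTT' L 1 tp U =
      ∑ v : TorusSite 2 L, relabel (Orb.translate v)
        (fermionEmbed (PolySite.toTorusEmb L h) (curDeriv2ObsTT tp U)) := by
  have hInj : Set.InjOn (Torus.proj (d := 2) L) ↑(thicken (box 2 3) 1) :=
    injOn_proj_thicken_box_one (by omega)
  have h23 : box 2 2 ⊆ box 2 3 := box_subset_box (by norm_num)
  have hB : hubbardTorusTT' L 1 tp U * curOpTT' L tp - curOpTT' L tp * hubbardTorusTT' L 1 tp U =
      ∑ v : TorusSite 2 L, relabel (Orb.translate v)
        (fermionEmbed (PolySite.toTorusEmb L (hInj.mono (by exact_mod_cast subset_thicken (box 2 3) 1)))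
          (fermionEmbed (PolySite.incl h23) (curDerivObsTT tp U))) := by
    rw [hubbardTorusTT'_commutator_curOpTT' L tp U (by omega) (h.mono (Finset.coe_subset.2 h23))]
    refine Finset.sum_congr rfl fun v _ => ?_
    rw [fermionEmbed_toTorusEmb_incl]
  rw [hB, hubbardTorusTT'_commutator_sum_relabel_translate L 1 tp U h23 (thicken_box_one_subset 2 2) hInj
    (curDerivObsTT tp U)]
  rfl

/-- Anti-Hermiticity of `B = H𝒥 − 𝒥H` (`t–t'` torus). [folklore] -/
theorem conjTranspose_commutator_curOpTT'_TT (tp U : ℝ) :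
    (hubbardTorusTT' L 1 tp U * curOpTT' L tp - curOpTT' L tp * hubbardTorusTT' L 1 tp U)ᴴ =
      -(hubbardTorusTT' L 1 tp U * curOpTT' L tp - curOpTT' L tp * hubbardTorusTT' L 1 tp U) := by
  have hH : (hubbardTorusTT' L 1 tp U)ᴴ = hubbardTorusTT' L 1 tp U := (hubbardTorusTT'_isHermitian L 1 tp U).eq
  have hJ : (curOpTT' L tp)ᴴ = curOpTT' L tp := (isHermitian_curOpTT' (L := L) tp).eq
  rw [conjTranspose_sub, conjTranspose_mul, conjTranspose_mul, hH, hJ, neg_sub]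

end Finite

end Summit.Ventures.CertifiedManyBodySolver.Observables

end
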